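import Literature.Analysis.Complex.LoewnerFastTrackJensen
import HarnessLib

/-!
# Halmos's unitary dilation of a contraction (finite-dimensional form)

P. R. Halmos, *A Hilbert Space Problem Book*, 2nd ed., Graduate Texts in Mathematics 19, Springer
1982 [Halmos1982], Chapter 23 "Unitary dilations", Problem 222 and Solution 222.

**Compression / dilation** (Problem 222, opening paragraph): if `K = H ⊕ H⊥` and operators on `K`
are written as `2 × 2` operator matrices, then `B` is a *dilation* of `A` (equivalently `A` is the
*compression* of `B` to `H`, `AP = PBP` with `P` the projection onto `H`) if and only if the matrix
of `B` has the form `[[A, X], [Y, Z]]`.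

**Problem 222 (a).** *If `‖A‖ ≤ 1`, then `A` has a unitary dilation.*

**Solution 222.** With `K = H ⊕ H`, `S = √(1 - AA⋆)`, `T = √(1 - A⋆A)` (positive square roots;
"since `‖A‖ ≤ 1`, it follows that `1 - AA⋆` and `1 - A⋆A` are positive"), the operator matrix
`B = [[A, S], [T, -A⋆]]` is unitary and is a dilation of `A`; the computation uses `S² = 1 - AA⋆`,
`T² = 1 - A⋆A` and the intertwining `SA = AT`, `A⋆S = TA⋆`. Halmos also notes that the hypothesis
is necessary: a compression of a contraction is a contraction (`‖Af‖ = ‖PBf‖ ≤ ‖Bf‖ ≤ ‖f‖`).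

Here `H = ℂ^m` (square matrices indexed by a `Fintype`), the norm is the `ℓ²`-operator norm
(scope `Matrix.Norms.L2Operator`), positivity is `Matrix.PosSemidef`, and the square roots are
`cfc Real.sqrt`. The unitarity computation is the one already carried out inside
`Literature.Analysis.Complex.conj_cfc_sub_cfc_conj_posSemidef` (Hansen–Pedersen's proof of
Jensen's operator inequality); its public lemmas
`Literature.Analysis.Complex.mul_cfc_one_sub_star_mul_self` (the intertwining `A F(1 - A⋆A) =
F(1 - AA⋆) A`) and `Literature.Analysis.Complex.cfc_sqrt_mul_self` (`√P √P = P`) are reused, not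
re-proved. NOT vendored: the infinite-dimensional statement (bounded operators on an arbitrary
Hilbert space), Problem 222 (b) (projection dilations of `0 ≤ A ≤ 1`), the corollary "every
operator has a normal dilation", and Sz.-Nagy's unitary *power* dilation (Problem 227).
TODO(general form): bounded operators on a Hilbert space; Sz.-Nagy's power dilation.

## Main statements

* `IsDilationOf B A` — Halmos's matrix criterion (`B.toBlocks₁₁ = A`), equivalent to the
  compression identity `P B P = A ⊕ 0` (`isDilationOf_iff_proj_mul_mul_proj`);
* `halmosDilation A` — the matrix `[[A, √(1 - AAᴴ)], [√(1 - AᴴA), -Aᴴ]]` on `m ⊕ m`; it is a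
  dilation of `A` (`isDilationOf_halmosDilation`);
* `norm_le_one_iff_posSemidef_one_sub` — `‖A‖ ≤ 1 ↔ 1 - AᴴA ≥ 0` (the positivity step of
  Solution 222, with its converse);
* `halmosDilation_mem_unitaryGroup` — `halmosDilation A` is unitary when `1 - AᴴA ≥ 0` and
  `1 - AAᴴ ≥ 0`; `halmosDilation_mem_unitaryGroup_of_norm_le_one` — … when `‖A‖ ≤ 1`;
* `exists_unitary_dilation_of_norm_le_one` — **Problem 222 (a)** as printed;
* `norm_le_one_of_isDilationOf_unitary` — necessity: a compression of a unitary is a contraction.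

## References

* [Halmos1982] P. R. Halmos, *A Hilbert Space Problem Book*, 2nd ed., Springer GTM 19 (1982),
  Problem 222 (a) and Solution 222 (Chapter 23, "Unitary dilations").
-/

noncomputable section

open scoped ComplexOrder MatrixOrder Matrix.Norms.L2Operator InnerProductSpace
open Matrix WithLp

namespace Literature.Analysis.OperatorTheory

variable {m : Type*} [Fintype m] [DecidableEq m]

/-! ## Compressions and dilations as block matrices -/

omit [Fintype m] [DecidableEq m] in
/-- `B` (an operator on `H ⊕ H`, written as a `2 × 2` block matrix) is a **dilation** of `A`, i.e.
`A` is the **compression** of `B` to the first summand: the upper-left block of `B` is `A`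
(Halmos's matrix criterion `B = [[A, X], [Y, Z]]`). [cite: Halmos1982, Problem 222 (opening
discussion, display `(A X; Y Z)`)] -/
def IsDilationOf (B : Matrix (m ⊕ m) (m ⊕ m) ℂ) (A : Matrix m m ℂ) : Prop :=
  B.toBlocks₁₁ = A

omit [Fintype m] [DecidableEq m] in
/-- Unfolding of `IsDilationOf`. [cite: Halmos1982, Problem 222 (display `(A X; Y Z)`)] -/
theorem isDilationOf_iff (B : Matrix (m ⊕ m) (m ⊕ m) ℂ) (A : Matrix m m ℂ) :
    IsDilationOf B A ↔ B.toBlocks₁₁ = A :=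
  Iff.rfl

/-- The matrix criterion is the compression identity `P B P = A ⊕ 0` with `P = 1 ⊕ 0` the
projection onto the first summand (`AP = PBP` in Halmos's notation). [cite: Halmos1982, Problem 222
(displays `Af = PBf`, `AP = PBP`); Solution 222 (`P = (1 0; 0 0)`)] -/
theorem isDilationOf_iff_proj_mul_mul_proj (B : Matrix (m ⊕ m) (m ⊕ m) ℂ) (A : Matrix m m ℂ) :
    IsDilationOf B A ↔
      fromBlocks (1 : Matrix m m ℂ) 0 0 (0 : Matrix m m ℂ) * B * fromBlocks 1 0 0 0 =
        fromBlocks A 0 0 0 := by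
  conv_lhs => rw [IsDilationOf]
  conv_rhs => rw [← B.fromBlocks_toBlocks, fromBlocks_multiply, fromBlocks_multiply]
  simp only [Matrix.one_mul, Matrix.zero_mul, Matrix.mul_one, Matrix.mul_zero, add_zero,
    fromBlocks_inj, and_true]

/-! ## `‖A‖ ≤ 1` versus `1 - A⋆A ≥ 0` -/

omit [DecidableEq m] in
/-- `v⋆ · v = ‖v‖²` for the Euclidean norm on `ℂ^m` (plumbing). [folklore] -/
private theorem star_dotProduct_self_eq_norm_sq (v : m → ℂ) :
    star v ⬝ᵥ v = ((‖toLp 2 v‖ : ℝ) : ℂ) ^ 2 := by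
  rw [dotProduct_comm, ← EuclideanSpace.inner_toLp_toLp, inner_self_eq_norm_sq_to_K]
  norm_cast

/-- `‖Av‖ ≤ ‖A‖ ‖v‖` for the `ℓ²`-operator norm (Mathlib's `Matrix.l2_opNorm_mulVec`, restated on
`m → ℂ`; plumbing). [folklore] -/
private theorem norm_toLp_mulVec_le (A : Matrix m m ℂ) (v : m → ℂ) :
    ‖toLp 2 (A *ᵥ v)‖ ≤ ‖A‖ * ‖toLp 2 v‖ := by
  simpa using Matrix.l2_opNorm_mulVec A (toLp 2 v)

/-- The quadratic form of `1 - A⋆A`: `v⋆(1 - A⋆A)v = ‖v‖² - ‖Av‖²` ("`‖Af‖ ≤ ‖f‖`" is the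
positivity of `1 - A⋆A`). [cite: Halmos1982, Problem 222 (note after the statement:
`‖Af‖ = ‖PBf‖ ≤ ‖Bf‖ ≤ ‖f‖`)] -/
theorem star_dotProduct_one_sub_conjTranspose_mul_self_mulVec (A : Matrix m m ℂ) (v : m → ℂ) :
    star v ⬝ᵥ ((1 - Aᴴ * A) *ᵥ v) =
      ((‖toLp 2 v‖ : ℝ) : ℂ) ^ 2 - ((‖toLp 2 (A *ᵥ v)‖ : ℝ) : ℂ) ^ 2 := by
  rw [sub_mulVec, dotProduct_sub, one_mulVec, ← mulVec_mulVec, dotProduct_mulVec _ Aᴴ,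
    vecMul_conjTranspose, star_star, star_dotProduct_self_eq_norm_sq,
    star_dotProduct_self_eq_norm_sq]

/-- "Since `‖A‖ ≤ 1`, it follows that `1 - A⋆A` is positive" — and conversely: for the
`ℓ²`-operator norm, `‖A‖ ≤ 1 ↔ 1 - A⋆A ≥ 0`. [cite: Halmos1982, Solution 222 (positivity of
`1 - A⋆A`); Problem 222 (note: a compression of a contraction is a contraction)] -/
theorem norm_le_one_iff_posSemidef_one_sub (A : Matrix m m ℂ) :
    ‖A‖ ≤ 1 ↔ (1 - Aᴴ * A).PosSemidef := by
  constructor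
  · intro hA
    refine .of_dotProduct_mulVec_nonneg
      (Matrix.isHermitian_one.sub (Matrix.isHermitian_conjTranspose_mul_self A)) fun v => ?_
    rw [star_dotProduct_one_sub_conjTranspose_mul_self_mulVec, sub_nonneg]
    have h1 : ‖toLp 2 (A *ᵥ v)‖ ≤ ‖toLp 2 v‖ :=
      (norm_toLp_mulVec_le A v).trans (mul_le_of_le_one_left (norm_nonneg _) hA)
    have h2 : ‖toLp 2 (A *ᵥ v)‖ ^ 2 ≤ ‖toLp 2 v‖ ^ 2 := by gcongr
    exact_mod_cast h2
  · intro h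
    rw [← Matrix.l2_opNorm_toEuclideanCLM]
    refine ContinuousLinearMap.opNorm_le_bound _ zero_le_one fun x => ?_
    have hx := h.dotProduct_mulVec_nonneg (ofLp x)
    rw [star_dotProduct_one_sub_conjTranspose_mul_self_mulVec, sub_nonneg] at hx
    have h2 : ‖toLp 2 (A *ᵥ ofLp x)‖ ^ 2 ≤ ‖toLp 2 (ofLp x)‖ ^ 2 := by exact_mod_cast hx
    have h3 : ‖toLp 2 (A *ᵥ ofLp x)‖ ≤ ‖toLp 2 (ofLp x)‖ :=
      (pow_le_pow_iff_left₀ (norm_nonneg _) (norm_nonneg _) two_ne_zero).1 h2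
    have h4 : toEuclideanCLM (n := m) (𝕜 := ℂ) A x = toLp 2 (A *ᵥ ofLp x) := by
      rw [← Matrix.ofLp_toEuclideanCLM, toLp_ofLp]
    rw [h4, one_mul]
    simpa only [toLp_ofLp] using h3

/-- "Since `‖A‖ ≤ 1`, it follows that `1 - A⋆A` is positive." [cite: Halmos1982, Solution 222] -/
theorem posSemidef_one_sub_conjTranspose_mul_self_of_norm_le_one {A : Matrix m m ℂ}
    (hA : ‖A‖ ≤ 1) : (1 - Aᴴ * A).PosSemidef :=
  (norm_le_one_iff_posSemidef_one_sub A).1 hA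

/-- "… and `1 - AA⋆` is positive" (the previous statement for `A⋆`, `‖A⋆‖ = ‖A‖`).
[cite: Halmos1982, Solution 222] -/
theorem posSemidef_one_sub_mul_conjTranspose_self_of_norm_le_one {A : Matrix m m ℂ}
    (hA : ‖A‖ ≤ 1) : (1 - A * Aᴴ).PosSemidef := by
  have h : ‖Aᴴ‖ ≤ 1 := by rwa [Matrix.l2_opNorm_conjTranspose]
  simpa only [conjTranspose_conjTranspose] using
    posSemidef_one_sub_conjTranspose_mul_self_of_norm_le_one h

/-! ## Halmos's matrix and Problem 222 (a) -/

/-- **Halmos's dilation matrix** `B = [[A, S], [T, -A⋆]]`, `S = √(1 - AA⋆)`, `T = √(1 - A⋆A)`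
(square roots through the continuous functional calculus). [cite: Halmos1982, Solution 222
(displays for `S`, `T`, `B`)] -/
def halmosDilation (A : Matrix m m ℂ) : Matrix (m ⊕ m) (m ⊕ m) ℂ :=
  fromBlocks A (cfc Real.sqrt (1 - A * Aᴴ)) (cfc Real.sqrt (1 - Aᴴ * A)) (-Aᴴ)

/-- Unfolding of `halmosDilation`. [cite: Halmos1982, Solution 222 (display for `B`)] -/
theorem halmosDilation_def (A : Matrix m m ℂ) :
    halmosDilation A =
      fromBlocks A (cfc Real.sqrt (1 - A * Aᴴ)) (cfc Real.sqrt (1 - Aᴴ * A)) (-Aᴴ) :=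
  rfl

/-- `B` is a dilation of `A`: "That B is a dilation of A is clear." [cite: Halmos1982,
Solution 222] -/
@[simp]
theorem halmosDilation_toBlocks₁₁ (A : Matrix m m ℂ) : (halmosDilation A).toBlocks₁₁ = A := by
  simp [halmosDilation]

/-- `B` is a dilation of `A` (in the sense of `IsDilationOf`). [cite: Halmos1982, Solution 222] -/
theorem isDilationOf_halmosDilation (A : Matrix m m ℂ) : IsDilationOf (halmosDilation A) A :=
  halmosDilation_toBlocks₁₁ A

/-- The compression identity `P B P = A ⊕ 0` for Halmos's matrix. [cite: Halmos1982, Problem 222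
(`AP = PBP`); Solution 222 (`P = (1 0; 0 0)`)] -/
theorem proj_mul_halmosDilation_mul_proj (A : Matrix m m ℂ) :
    fromBlocks (1 : Matrix m m ℂ) 0 0 (0 : Matrix m m ℂ) * halmosDilation A * fromBlocks 1 0 0 0 =
      fromBlocks A 0 0 0 :=
  (isDilationOf_iff_proj_mul_mul_proj _ _).1 (isDilationOf_halmosDilation A)

/-- **Solution 222 (the computation).** If `1 - A⋆A ≥ 0` and `1 - AA⋆ ≥ 0` then
`B = [[A, S], [T, -A⋆]]` is unitary: with `S² = 1 - AA⋆`, `T² = 1 - A⋆A`, `AT = SA`,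
`TA⋆ = A⋆S` one gets `BB⋆ = [[AA⋆ + S², AT - SA], [TA⋆ - A⋆S, T² + A⋆A]] = 1` (and `B⋆B = 1`).
The computation is the one of `Literature.Analysis.Complex.conj_cfc_sub_cfc_conj_posSemidef`.
[cite: Halmos1982, Solution 222] -/
theorem halmosDilation_mem_unitaryGroup {A : Matrix m m ℂ} (hA : (1 - Aᴴ * A).PosSemidef)
    (hA' : (1 - A * Aᴴ).PosSemidef) : halmosDilation A ∈ Matrix.unitaryGroup (m ⊕ m) ℂ := by
  rw [halmosDilation_def]
  -- the defect operators `T = c = √(1 - A⋆A)`, `S = b = √(1 - AA⋆)`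
  set c : Matrix m m ℂ := cfc Real.sqrt (1 - Aᴴ * A) with hc
  set b : Matrix m m ℂ := cfc Real.sqrt (1 - A * Aᴴ) with hb
  have hch : c.IsHermitian := (cfc_predicate Real.sqrt (1 - Aᴴ * A) : IsSelfAdjoint _)
  have hbh : b.IsHermitian := (cfc_predicate Real.sqrt (1 - A * Aᴴ) : IsSelfAdjoint _)
  have hcc : c * c = 1 - Aᴴ * A := Literature.Analysis.Complex.cfc_sqrt_mul_self hA
  have hbb : b * b = 1 - A * Aᴴ := Literature.Analysis.Complex.cfc_sqrt_mul_self hA'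
  have hac : A * c = b * A :=
    Literature.Analysis.Complex.mul_cfc_one_sub_star_mul_self A Real.sqrt
  have hca : c * Aᴴ = Aᴴ * b := by
    have h := congrArg star hac
    rw [star_mul, star_mul, star_eq_conjTranspose c, hch.eq, star_eq_conjTranspose b, hbh.eq] at h
    exact h
  have haa : A * Aᴴ + b * b = 1 := by rw [hbb]; abel
  have hcc' : c * c + Aᴴ * A = 1 := by rw [hcc]; abel
  have hsU : star (fromBlocks A b c (-Aᴴ)) = fromBlocks Aᴴ c b (-A) := by
    rw [star_eq_conjTranspose, fromBlocks_conjTranspose, hch.eq, hbh.eq, conjTranspose_neg,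
      conjTranspose_conjTranspose]
  rw [Matrix.mem_unitaryGroup_iff, hsU, fromBlocks_multiply, ← fromBlocks_one]
  refine Matrix.fromBlocks_inj.mpr ⟨haa, ?_, ?_, ?_⟩
  · rw [hac, Matrix.mul_neg]; abel
  · rw [hca, Matrix.neg_mul]; abel
  · rw [Matrix.neg_mul, Matrix.mul_neg, neg_neg, hcc']

/-- `B⋆B = 1`. [cite: Halmos1982, Solution 222 ("by direct computation")] -/
theorem star_halmosDilation_mul_self {A : Matrix m m ℂ} (hA : (1 - Aᴴ * A).PosSemidef)
    (hA' : (1 - A * Aᴴ).PosSemidef) : star (halmosDilation A) * halmosDilation A = 1 :=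
  Matrix.mem_unitaryGroup_iff'.1 (halmosDilation_mem_unitaryGroup hA hA')

/-- `BB⋆ = 1`. [cite: Halmos1982, Solution 222 ("by direct computation")] -/
theorem halmosDilation_mul_star_self {A : Matrix m m ℂ} (hA : (1 - Aᴴ * A).PosSemidef)
    (hA' : (1 - A * Aᴴ).PosSemidef) : halmosDilation A * star (halmosDilation A) = 1 :=
  Matrix.mem_unitaryGroup_iff.1 (halmosDilation_mem_unitaryGroup hA hA')

/-- **Halmos, Problem 222 (a)** (finite-dimensional form): if `‖A‖ ≤ 1` (`ℓ²`-operator norm on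
`ℂ^m`), then Halmos's matrix `[[A, √(1 - AA⋆)], [√(1 - A⋆A), -A⋆]]` is a unitary operator on
`ℂ^m ⊕ ℂ^m` whose compression to the first summand is `A`. [cite: Halmos1982, Problem 222 (a);
Solution 222] -/
theorem halmosDilation_mem_unitaryGroup_of_norm_le_one {A : Matrix m m ℂ} (hA : ‖A‖ ≤ 1) :
    halmosDilation A ∈ Matrix.unitaryGroup (m ⊕ m) ℂ :=
  halmosDilation_mem_unitaryGroup (posSemidef_one_sub_conjTranspose_mul_self_of_norm_le_one hA)
    (posSemidef_one_sub_mul_conjTranspose_self_of_norm_le_one hA)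

/-- **Halmos, Problem 222 (a)**: *if `‖A‖ ≤ 1`, then `A` has a unitary dilation* — realised on
the doubled space `H ⊕ H`, `H = ℂ^m`. [cite: Halmos1982, Problem 222 (a); Solution 222] -/
theorem exists_unitary_dilation_of_norm_le_one {A : Matrix m m ℂ} (hA : ‖A‖ ≤ 1) :
    ∃ U ∈ Matrix.unitaryGroup (m ⊕ m) ℂ, IsDilationOf U A :=
  ⟨halmosDilation A, halmosDilation_mem_unitaryGroup_of_norm_le_one hA,
    isDilationOf_halmosDilation A⟩

/-! ## Necessity of the hypothesis -/

/-- If `U = [[A, X], [Y, Z]]` is unitary then `1 - A⋆A = Y⋆Y ≥ 0`: a compression of a unitary is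
a contraction ("if A has a dilation B that is a contraction, then `‖Af‖ = ‖PBf‖ ≤ ‖Bf‖ ≤ ‖f‖`").
[cite: Halmos1982, Problem 222 (note after the statement)] -/
theorem posSemidef_one_sub_of_isDilationOf_unitary {U : Matrix (m ⊕ m) (m ⊕ m) ℂ}
    (hU : U ∈ Matrix.unitaryGroup (m ⊕ m) ℂ) {A : Matrix m m ℂ} (h : IsDilationOf U A) :
    (1 - Aᴴ * A).PosSemidef := by
  have h1 : star U * U = 1 := Matrix.mem_unitaryGroup_iff'.1 hU
  rw [← U.fromBlocks_toBlocks, star_eq_conjTranspose, fromBlocks_conjTranspose,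
    fromBlocks_multiply, ← fromBlocks_one, fromBlocks_inj] at h1
  obtain ⟨h11, -, -, -⟩ := h1
  rw [(isDilationOf_iff U A).1 h] at h11
  have h2 : 1 - Aᴴ * A = (U.toBlocks₂₁)ᴴ * U.toBlocks₂₁ := by rw [← h11]; abel
  rw [h2]
  exact Matrix.posSemidef_conjTranspose_mul_self _

/-- A compression of a unitary is a contraction: if `A` has a unitary dilation then `‖A‖ ≤ 1`
("the assumptions are clearly necessary"). [cite: Halmos1982, Problem 222 (note after the
statement)] -/
theorem norm_le_one_of_isDilationOf_unitary {U : Matrix (m ⊕ m) (m ⊕ m) ℂ}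
    (hU : U ∈ Matrix.unitaryGroup (m ⊕ m) ℂ) {A : Matrix m m ℂ} (h : IsDilationOf U A) :
    ‖A‖ ≤ 1 :=
  (norm_le_one_iff_posSemidef_one_sub A).2 (posSemidef_one_sub_of_isDilationOf_unitary hU h)

/-- **Problem 222 (a) with its converse**: `A` has a unitary dilation on `H ⊕ H` if and only if
`‖A‖ ≤ 1`. [cite: Halmos1982, Problem 222 (a) and the note after it; Solution 222] -/
theorem exists_unitary_dilation_iff_norm_le_one (A : Matrix m m ℂ) :
    (∃ U ∈ Matrix.unitaryGroup (m ⊕ m) ℂ, IsDilationOf U A) ↔ ‖A‖ ≤ 1 :=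
  ⟨fun ⟨_, hU, h⟩ => norm_le_one_of_isDilationOf_unitary hU h,
    exists_unitary_dilation_of_norm_le_one⟩

end Literature.Analysis.OperatorTheory
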